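import Summits.BirchSwinnertonDyer.Rank1Residual.P2.CongruentNumberOddAokiMonskyKernel
import Summits.BirchSwinnertonDyer.Rank1Residual.P2.CongruentNumberOddAokiMonskyRestrict
import Summits.BirchSwinnertonDyer.Rank1Residual.P2.CongruentNumberOddAokiMonskyShape
import HarnessLib

/-!
# Cell `bsd-monsky`: AOKI = MONSKY, THE ODD CLASS `n ≡ 3 (mod 8)` — the theorem:
# `selmerDimFormula (p₁⋯p_k) = 2 + s_odd(p₁⋯p_k)` for every square-free `n = p₁⋯p_k ≡ 3 (mod 8)` (nothing asserted)

HONEST FRAMING (cell `bsd-monsky`, run/shared/lean/pub/bsd-monsky/, README §1: ONE theorem on ONE explicit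
infinite family at the prime `2`; nothing here is part of it). This file asserts NO arithmetic fact. It proves, for
EVERY `k` and every injective family of primes with `n = p₁⋯p_k ≡ 3 (mod 8)`, that Aoki 1999 Thm 2.2's closed
formula `selmerDimFormula n` equals `2 + monskySelmerRankOdd p` (Monsky's ODD matrix count, appendix to
Heath-Brown 1994, p. 39: `M = ( A + D₂  D₂ ; D₂  A + D₋₂ )`) — the second of the three classes of Aoki's typed
range (`n ≡ 6 (mod 8)`: `…EvenAokiMonskyAllPrimes.lean`; `n ≡ 7 (mod 8)`: OWED, HOME/proof/PROOF-B-AOKI-MONSKY.md §5).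
Hence from Aoki's refereed theorem alone `#Sel₂(E_{p₁⋯p_k}) = 2^{2 + s_odd}` on this class (the odd case of HB94 is
itself fully proved in print: this is a kernel consistency check of two published 2-descents, no flag rides on it).

Proof: the odd kernel count (`…OddAokiMonskyKernel.lean`) gives `s + 2 rank C + rank(G|W₀) = |T₁| + k` with
`W₀ = {u : (u ᵥ* Aᵀ)_{T₁} = 0}`; Aoki's `Λ_{S,T} ≅ C` (`S = {p_i}`, `T = T₁`, no prime `2`), and his essential space
is `W₃ = W₀ ∩ {x_w ≡ ±1 (8)} = W₀ ∩ ker (t ⬝ ·)` (`…OddAokiMonskyShape.lean`); for the Gram form `B = toBilin' G`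
one has `B(𝟙, ·) = t ⬝ ·` (zero row sums of `A`) and `B(𝟙, 𝟙) = Σ t_i = 1` (`n ≡ 3 (mod 8)`, through `χ₈`), so by
the restriction lemma R2 (`…OddAokiMonskyRestrict.lean`) `rad W₃ = rad W₀` while `dim W₃ = dim W₀ − 1`:
`rank(G|W₃) = rank(G|W₀) − 1`, and `d = 1 + k + |T₁| − 2 rank C − rank(G|W₃) = 2 + s`.

References: [Aoki1999] Thm. 2.2 p. 81, proof p. 98, Thm. 4.1 p. 87; [HeathBrown1994SelmerCongruentII] Appendix
(Monsky), typescript p. 39 L10–L33; [IrelandRosen1990] Ch. 5 §§1–2.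
-/

noncomputable section

open scoped Classical

open Matrix WeierstrassCurve Literature.NumberTheory.EllipticCurves
  Literature.NumberTheory.EllipticCurves.Aoki1999
  Literature.NumberTheory.EllipticCurves.HeathBrown1994
  Literature.NumberTheory.EllipticCurves.HeathBrown1994.Families
  Literature.NumberTheory.QuadraticForms

set_option autoImplicit false

namespace Summit.BirchSwinnertonDyer.Rank1Residual.P2.AokiMonsky

variable {k : ℕ} (p : Fin k → ℕ) (hp : ∀ i, (p i).Prime) (hinj : Function.Injective p)

/-- All `pᵢ` are odd when `p₁⋯p_k` is odd. [folklore] -/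
theorem odd_of_prod_odd (hP : (∏ i, p i) % 2 = 1) : ∀ i, Odd (p i) := by
  have hP' : Odd (∏ i, p i) := Nat.odd_iff.mpr hP
  exact fun i => hP'.of_dvd_nat (Finset.dvd_prod_of_mem p (Finset.mem_univ i))

/-- **Zero row sums of `A` read on `G`: `Σ_i G_il = t_l`**, hence `B(𝟙, u) = t ⬝ u` for `B = toBilin' G`. [folklore] -/
theorem one_vecMul_gram (l : Fin k) :
    ((fun _ => (1 : ZMod 2)) ᵥ* (Matrix.of fun i l : Fin k =>
      (∑ j, addLegendreSym (-1) (p j) * ((legendreMatrix p)ᵀ i j * (legendreMatrix p)ᵀ l j)) +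
        if i = l then addLegendreSym 2 (p i) else 0)) l = addLegendreSym 2 (p l) := by
  simp only [Matrix.vecMul, dotProduct, Matrix.of_apply, one_mul, Finset.sum_add_distrib, Finset.sum_ite_eq',
    Finset.mem_univ, if_true]
  suffices h : ∑ i, ∑ j, addLegendreSym (-1) (p j) * ((legendreMatrix p)ᵀ i j * (legendreMatrix p)ᵀ l j) = 0 by
    rw [h, zero_add]
  rw [Finset.sum_comm]
  refine Finset.sum_eq_zero fun j _ => ?_
  have : ∑ i, addLegendreSym (-1) (p j) * ((legendreMatrix p)ᵀ i j * (legendreMatrix p)ᵀ l j) =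
      addLegendreSym (-1) (p j) * (legendreMatrix p)ᵀ l j * ∑ i, (legendreMatrix p)ᵀ i j := by
    rw [Finset.mul_sum]
    exact Finset.sum_congr rfl fun i _ => by ring
  rw [this, transposeA_sum_col p j, mul_zero]

include hp hinj in
/-- **`Λ_{S,T} ≅ Aᵀ|_{ι × T₁}`** for `n ≡ 3 (mod 8)` (`S = {p_i}`, `T = T₁`; `λ_{p_j}(p_i) = (Aᵀ)_ij`). [cite: Aoki1999, Thm. 2.2 p. 81] -/
theorem rank_lamMatrix_prod_three_eq (h3 : (∏ i, p i) % 8 = 3) :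
    (lamMatrix (∏ i, p i) (sSet (∏ i, p i)) (tSet (∏ i, p i))).rank =
      ((legendreMatrix p)ᵀ.submatrix id (Subtype.val : {j // addLegendreSym (-1) (p j) = 0} → Fin k)).rank := by
  have hodd := odd_of_prod_odd p (by omega)
  have hS := sSet_prod p hp hinj
  have hT := tSet_prod_three p hp hinj h3
  have hmemS : ∀ i, p i ∈ sSet (∏ i, p i) := fun i => by
    rw [hS]; exact Finset.mem_image_of_mem _ (Finset.mem_univ i)
  have hmemT : ∀ j : {j // addLegendreSym (-1) (p j) = 0}, p j.1 ∈ tSet (∏ i, p i) := fun j => by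
    rw [hT]
    exact Finset.mem_image_of_mem _ (Finset.mem_filter.mpr
      ⟨Finset.mem_univ _, (eps_eq_zero_iff p hodd j.1).mp j.2⟩)
  let eS : Fin k ≃ ↥(sSet (∏ i, p i)) := Equiv.ofBijective (fun i => ⟨p i, hmemS i⟩)
    ⟨fun i j h => hinj (Subtype.ext_iff.mp h), fun x => by
      obtain ⟨xv, hxv⟩ := x
      rw [hS] at hxv
      obtain ⟨i, -, hi⟩ := Finset.mem_image.mp hxv
      exact ⟨i, Subtype.ext hi⟩⟩
  let eT : {j // addLegendreSym (-1) (p j) = 0} ≃ ↥(tSet (∏ i, p i)) :=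
    Equiv.ofBijective (fun j => ⟨p j.1, hmemT j⟩)
    ⟨fun i j h => Subtype.ext (hinj (Subtype.ext_iff.mp h)), fun x => by
      obtain ⟨xv, hxv⟩ := x
      rw [hT] at hxv
      obtain ⟨i, hi, hix⟩ := Finset.mem_image.mp hxv
      exact ⟨⟨i, (eps_eq_zero_iff p hodd i).mpr (Finset.mem_filter.mp hi).2⟩, Subtype.ext hix⟩⟩
  have h2 : (lamMatrix (∏ i, p i) (sSet (∏ i, p i)) (tSet (∏ i, p i))).submatrix eS eT =
      (legendreMatrix p)ᵀ.submatrix id (Subtype.val : {j // addLegendreSym (-1) (p j) = 0} → Fin k) := by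
    ext i j
    change lam (∏ i, p i) (p j.1) ((p i : ℕ) : ℤ) = _
    rw [Matrix.submatrix_apply, id, lam_odd_eq_transpose_legendreMatrix p hp hodd hinj i j.1]
  rw [← h2, Matrix.rank_submatrix]

include hp hinj in
/-- **Aoki's Gram matrix at `(p_i, p_l)` for odd `n`: `G_il = Σ_j ε_j (Aᵀ)_ij (Aᵀ)_lj + δ_il t_i`** (`ν = 0`).
[cite: Aoki1999, Thm. 2.2 p. 81, proof p. 98] -/
theorem gramMatrix_prime_prime_odd (h3 : (∏ i, p i) % 8 = 3) (i l : Fin k)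
    (hi : p i ∈ sOneSet (∏ i, p i)) (hl : p l ∈ sOneSet (∏ i, p i)) :
    gramMatrix (∏ i, p i) ⟨p i, hi⟩ ⟨p l, hl⟩ =
      (∑ j, addLegendreSym (-1) (p j) * ((legendreMatrix p)ᵀ i j * (legendreMatrix p)ᵀ l j)) +
        if i = l then addLegendreSym 2 (p i) else 0 := by
  have hodd := odd_of_prod_odd p (by omega)
  unfold gramMatrix
  rw [Matrix.of_apply]
  have hnu : nu (∏ i, p i) = 0 := by unfold nu; rw [if_neg (by omega)]
  rw [hnu, zero_mul, add_zero]
  congr 1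
  · rw [Finset.sum_coe_sort (sTwoSet (∏ i, p i))
        (fun q => lam (∏ i, p i) q ((p i : ℕ) : ℤ) * lam (∏ i, p i) q ((p l : ℕ) : ℤ)),
      sTwoSet_prod_three p hp hodd hinj h3, Finset.sum_image fun x _ y _ h => hinj h, Finset.sum_filter]
    refine Finset.sum_congr rfl fun j _ => ?_
    rw [eps_eq_ite p hodd j]
    by_cases hj : p j % 4 = 1
    · rw [if_pos hj, if_neg (not_not.mpr hj), zero_mul]
    · rw [if_neg hj, if_pos hj, one_mul, lam_odd_eq_transpose_legendreMatrix p hp hodd hinj i j,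
        lam_odd_eq_transpose_legendreMatrix p hp hodd hinj l j]
  · by_cases hil : i = l
    · subst hil
      rw [if_pos rfl, if_pos rfl, lam_two_prime p hp hodd]
    · have hne : (⟨p i, hi⟩ : ↥(sOneSet (∏ i, p i))) ≠ ⟨p l, hl⟩ := fun h =>
        hil (hinj (Subtype.ext_iff.mp h))
      rw [if_neg hne, if_neg hil]

include hp hinj in
/-- **`v(Sel₀) ≅ W₃ = {u ∈ W₀ : t ⬝ u = 0}` and the Gram matrices correspond** (`n ≡ 3 (mod 8)`).
[cite: Aoki1999, Thm. 2.2 p. 81, §2 p. 80, Thm. 4.1 p. 87] -/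
theorem rank_gramEssential_prod_three_eq (h3 : (∏ i, p i) % 8 = 3) :
    (gramEssential (∏ i, p i)).rank =
      (Matrix.of fun w w' : ↥(Finset.univ.filter fun u : Fin k → ZMod 2 =>
          (∀ j, addLegendreSym (-1) (p j) = 0 → (u ᵥ* (legendreMatrix p)ᵀ) j = 0) ∧
            (fun i => addLegendreSym 2 (p i)) ⬝ᵥ u = 0) =>
        (w : Fin k → ZMod 2) ⬝ᵥ ((Matrix.of fun i l : Fin k =>
          (∑ j, addLegendreSym (-1) (p j) * ((legendreMatrix p)ᵀ i j * (legendreMatrix p)ᵀ l j)) +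
            if i = l then addLegendreSym 2 (p i) else 0) *ᵥ (w' : Fin k → ZMod 2))).rank := by
  have hodd := odd_of_prod_odd p (by omega)
  have hS1 := sOneSet_prod p hp hodd hinj
  have hT := tSet_prod_three p hp hinj h3
  have hmemS : ∀ i, p i ∈ sOneSet (∏ i, p i) := fun i => by
    rw [hS1]; exact Finset.mem_image_of_mem _ (Finset.mem_univ i)
  let eS : Fin k ≃ ↥(sOneSet (∏ i, p i)) := Equiv.ofBijective (fun i => ⟨p i, hmemS i⟩)
    ⟨fun i j h => hinj (Subtype.ext_iff.mp h), fun x => by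
      obtain ⟨xv, hxv⟩ := x
      rw [hS1] at hxv
      obtain ⟨i, -, hi⟩ := Finset.mem_image.mp hxv
      exact ⟨i, Subtype.ext hi⟩⟩
  have heS : ∀ i, (eS i : ℕ) = p i := fun i => rfl
  have hn0 : (∏ i, p i) ≠ 0 := Finset.prod_ne_zero_iff.mpr fun i _ => (hp i).ne_zero
  -- the symbol sums in the essential conditions, reindexed
  have hlam : ∀ (u : Fin k → ZMod 2) (q : ℕ), lam (∏ i, p i) q
      (rep (∏ i, p i) fun x : ↥(sOneSet (∏ i, p i)) => u (eS.symm x)) =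
      ∑ i, u i * lam (∏ i, p i) q ((p i : ℕ) : ℤ) := by
    intro u q
    rw [lam_rep hn0]
    exact Fintype.sum_equiv eS.symm _ _ fun x => by rw [← heS (eS.symm x), Equiv.apply_symm_apply]
  have hmemW : ∀ u : Fin k → ZMod 2,
      (fun x : ↥(sOneSet (∏ i, p i)) => u (eS.symm x)) ∈ essential (∏ i, p i) ↔
        (∀ j, addLegendreSym (-1) (p j) = 0 → (u ᵥ* (legendreMatrix p)ᵀ) j = 0) ∧
          (fun i => addLegendreSym 2 (p i)) ⬝ᵥ u = 0 := by
    intro u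
    unfold essential
    rw [Finset.mem_filter]
    simp only [Finset.mem_univ, true_and]
    rw [essentialCond_prod_three_iff p hp hodd hinj h3]
    have hsum2 : (∑ x : ↥(sOneSet (∏ i, p i)), (fun x => u (eS.symm x)) x * lam (∏ i, p i) 2 ((x : ℕ) : ℤ)) =
        (fun i => addLegendreSym 2 (p i)) ⬝ᵥ u := by
      rw [← lam_rep hn0, hlam]
      simp only [dotProduct]
      exact Finset.sum_congr rfl fun i _ => by rw [lam_two_prime p hp hodd, mul_comm]
    rw [hsum2]
    refine and_congr_left fun _ => ?_
    constructor
    · intro h j hj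
      have hq : p j ∈ tSet (∏ i, p i) := by
        rw [hT]
        exact Finset.mem_image_of_mem _
          (Finset.mem_filter.mpr ⟨Finset.mem_univ _, (eps_eq_zero_iff p hodd j).mp hj⟩)
      have := h (p j) hq
      rw [hlam] at this
      rw [← this]
      simp only [Matrix.vecMul, dotProduct]
      exact Finset.sum_congr rfl fun i _ => by rw [lam_odd_eq_transpose_legendreMatrix p hp hodd hinj i j]
    · intro h q hq
      rw [hT] at hq
      obtain ⟨j, hj, rfl⟩ := Finset.mem_image.mp hq
      have hεj : addLegendreSym (-1) (p j) = 0 :=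
        (eps_eq_zero_iff p hodd j).mpr (Finset.mem_filter.mp hj).2
      rw [hlam, ← h j hεj]
      simp only [Matrix.vecMul, dotProduct]
      exact Finset.sum_congr rfl fun i _ => by rw [lam_odd_eq_transpose_legendreMatrix p hp hodd hinj i j]
  have hWfin : ∀ u : Fin k → ZMod 2, u ∈ (Finset.univ.filter fun u : Fin k → ZMod 2 =>
      (∀ j, addLegendreSym (-1) (p j) = 0 → (u ᵥ* (legendreMatrix p)ᵀ) j = 0) ∧
        (fun i => addLegendreSym 2 (p i)) ⬝ᵥ u = 0) ↔
      (∀ j, addLegendreSym (-1) (p j) = 0 → (u ᵥ* (legendreMatrix p)ᵀ) j = 0) ∧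
        (fun i => addLegendreSym 2 (p i)) ⬝ᵥ u = 0 :=
    fun u => by rw [Finset.mem_filter]; simp only [Finset.mem_univ, true_and]
  have hback : ∀ w : ↥(sOneSet (∏ i, p i)) → ZMod 2,
      (fun x : ↥(sOneSet (∏ i, p i)) => (fun i => w (eS i)) (eS.symm x)) = w :=
    fun w => funext fun x => by simp only [Equiv.apply_symm_apply]
  let eW : ↥(Finset.univ.filter fun u : Fin k → ZMod 2 =>
      (∀ j, addLegendreSym (-1) (p j) = 0 → (u ᵥ* (legendreMatrix p)ᵀ) j = 0) ∧
        (fun i => addLegendreSym 2 (p i)) ⬝ᵥ u = 0) ≃ ↥(essential (∏ i, p i)) :=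
    { toFun := fun u => ⟨fun x => (u : Fin k → ZMod 2) (eS.symm x), (hmemW _).mpr ((hWfin _).mp u.2)⟩
      invFun := fun w => ⟨fun i => (w : ↥(sOneSet (∏ i, p i)) → ZMod 2) (eS i),
        (hWfin _).mpr ((hmemW _).mp (by rw [hback]; exact w.2))⟩
      left_inv := fun u => Subtype.ext (funext fun i => by simp only [Equiv.symm_apply_apply])
      right_inv := fun w => Subtype.ext (hback _) }
  rw [← Matrix.rank_submatrix (gramEssential (∏ i, p i)) eW eW]
  congr 1
  ext u u'
  rw [Matrix.submatrix_apply, Matrix.of_apply]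
  unfold gramEssential
  rw [Matrix.of_apply]
  change (fun x => (u : Fin k → ZMod 2) (eS.symm x)) ⬝ᵥ (gramMatrix (∏ i, p i) *ᵥ
      fun x => (u' : Fin k → ZMod 2) (eS.symm x)) = _
  simp only [dotProduct, Matrix.mulVec, Matrix.of_apply]
  refine (Fintype.sum_equiv eS _ _ fun i => ?_).symm
  rw [Equiv.symm_apply_apply]
  congr 1
  refine Fintype.sum_equiv eS _ _ fun l => ?_
  rw [Equiv.symm_apply_apply]
  congr 1
  exact (gramMatrix_prime_prime_odd p hp hinj h3 i l (hmemS i) (hmemS l)).symm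

/-- **The rank of Aoki's Gram form drops by exactly one from `W₀` to `W₃ = W₀ ∩ ker(t ⬝ ·)`** for `n ≡ 3 (mod 8)`:
`B(𝟙, ·) = t ⬝ ·`, `𝟙 ∈ W₀`, `B(𝟙, 𝟙) = Σ t_i = 1`, so R2 applies. [cite: Aoki1999, Thm. 2.2 p. 81] -/
theorem rank_gram_three_add_one (h3 : (∏ i, p i) % 8 = 3) :
    (Matrix.of fun w w' : ↥(Finset.univ.filter fun u : Fin k → ZMod 2 =>
          (∀ j, addLegendreSym (-1) (p j) = 0 → (u ᵥ* (legendreMatrix p)ᵀ) j = 0) ∧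
            (fun i => addLegendreSym 2 (p i)) ⬝ᵥ u = 0) =>
        (w : Fin k → ZMod 2) ⬝ᵥ ((Matrix.of fun i l : Fin k =>
          (∑ j, addLegendreSym (-1) (p j) * ((legendreMatrix p)ᵀ i j * (legendreMatrix p)ᵀ l j)) +
            if i = l then addLegendreSym 2 (p i) else 0) *ᵥ (w' : Fin k → ZMod 2))).rank + 1 =
      (Matrix.of fun w w' : ↥(Finset.univ.filter fun u : Fin k → ZMod 2 =>
          ∀ j, addLegendreSym (-1) (p j) = 0 → (u ᵥ* (legendreMatrix p)ᵀ) j = 0) =>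
        (w : Fin k → ZMod 2) ⬝ᵥ ((Matrix.of fun i l : Fin k =>
          (∑ j, addLegendreSym (-1) (p j) * ((legendreMatrix p)ᵀ i j * (legendreMatrix p)ᵀ l j)) +
            if i = l then addLegendreSym 2 (p i) else 0) *ᵥ (w' : Fin k → ZMod 2))).rank := by
  have hodd := odd_of_prod_odd p (by omega)
  -- abbreviations
  set L : Matrix (Fin k) (Fin k) (ZMod 2) := (legendreMatrix p)ᵀ with hL
  set G : Matrix (Fin k) (Fin k) (ZMod 2) := Matrix.of fun i l : Fin k =>
    (∑ j, addLegendreSym (-1) (p j) * (L i j * L l j)) + if i = l then addLegendreSym 2 (p i) else 0 with hG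
  set C : Matrix (Fin k) {j // addLegendreSym (-1) (p j) = 0} (ZMod 2) := L.submatrix id Subtype.val with hC
  set W₀ : Submodule (ZMod 2) (Fin k → ZMod 2) := LinearMap.ker Cᵀ.mulVecLin with hW₀
  set W₃ : Submodule (ZMod 2) (Fin k → ZMod 2) := W₀ ⊓ LinearMap.ker (Matrix.toBilin' G fun _ => 1) with hW₃
  -- membership
  have hmem₀ : ∀ u, u ∈ W₀ ↔ ∀ j, addLegendreSym (-1) (p j) = 0 → (u ᵥ* L) j = 0 := by
    intro u
    rw [hW₀, LinearMap.mem_ker, Matrix.mulVecLin_apply, Matrix.mulVec_transpose]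
    constructor
    · intro h j hj
      have := congr_fun h ⟨j, hj⟩
      simpa [hC, Matrix.vecMul, dotProduct] using this
    · intro h
      ext ⟨j, hj⟩
      simpa [hC, Matrix.vecMul, dotProduct] using h j hj
  have hBone : ∀ u, Matrix.toBilin' G (fun _ => 1) u = (fun i => addLegendreSym 2 (p i)) ⬝ᵥ u := by
    intro u
    rw [Matrix.toBilin'_apply', Matrix.dotProduct_mulVec]
    congr 1
    ext l
    exact one_vecMul_gram p l
  have hmem₃ : ∀ u, u ∈ W₃ ↔ (∀ j, addLegendreSym (-1) (p j) = 0 → (u ᵥ* L) j = 0) ∧ (fun i => addLegendreSym 2 (p i)) ⬝ᵥ u = 0 := by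
    intro u
    rw [hW₃, Submodule.mem_inf, hmem₀, LinearMap.mem_ker, hBone]
  have hWfin₀ : ∀ u : Fin k → ZMod 2,
      u ∈ (Finset.univ.filter fun u : Fin k → ZMod 2 => ∀ j, addLegendreSym (-1) (p j) = 0 → (u ᵥ* L) j = 0) ↔ u ∈ W₀ := by
    intro u; rw [Finset.mem_filter, hmem₀]; simp only [Finset.mem_univ, true_and]
  have hWfin₃ : ∀ u : Fin k → ZMod 2,
      u ∈ (Finset.univ.filter fun u : Fin k → ZMod 2 => (∀ j, addLegendreSym (-1) (p j) = 0 → (u ᵥ* L) j = 0) ∧ (fun i => addLegendreSym 2 (p i)) ⬝ᵥ u = 0) ↔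
        u ∈ W₃ := by
    intro u; rw [Finset.mem_filter, hmem₃]; simp only [Finset.mem_univ, true_and]
  -- Lemma 3 twice, bridged to the `BilinForm` radical
  have h0 := rank_gram_add_finrank G _ W₀ hWfin₀
  have h3' := rank_gram_add_finrank G _ W₃ hWfin₃
  rw [inf_ker_gram_eq_inf_orthogonal G _ W₀ hWfin₀] at h0
  rw [inf_ker_gram_eq_inf_orthogonal G _ W₃ hWfin₃] at h3'
  -- `𝟙 ∈ W₀`, `B(𝟙, 𝟙) = Σ t = 1`
  have hone : (fun _ => (1 : ZMod 2)) ∈ W₀ := by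
    rw [hmem₀]
    intro j _
    simp only [Matrix.vecMul, dotProduct, one_mul]
    exact transposeA_sum_col p j
  have hBoneone : Matrix.toBilin' G (fun _ => 1) (fun _ => 1) ≠ 0 := by
    rw [hBone]
    simp only [dotProduct, mul_one]
    rw [sum_t_eq_one_of_prod_mod_eight_three p hodd h3]
    exact one_ne_zero
  -- R2 and the hyperplane count
  have hrad : W₃ ⊓ (Matrix.toBilin' G).orthogonal W₃ = W₀ ⊓ (Matrix.toBilin' G).orthogonal W₀ := by
    rw [hW₃]
    exact rad_inf_ker_of_apply_self_ne_zero (Matrix.toBilin' G) W₀ hone hBoneone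
  have hdim : Module.finrank (ZMod 2) ↥W₃ + 1 = Module.finrank (ZMod 2) ↥W₀ := by
    rw [hW₃]
    exact finrank_inf_ker_add_one W₀ (Matrix.toBilin' G fun _ => 1) hone hBoneone
  rw [hrad] at h3'
  omega

include hp hinj in
/-- **AOKI = MONSKY ON THE CLASS `n ≡ 3 (mod 8)`, for every `k`.** For every injective family of primes with
`n = p₁⋯p_k ≡ 3 (mod 8)`: Aoki's `selmerDimFormula n` (Theorem 2.2) equals `2 + s_odd(n)`, `s_odd(n) = 2k − rank M`
Monsky's ODD matrix count. Pure bookkeeping between the two printed `2`-descents.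
[cite: Aoki1999, Thm. 2.2 p. 81 and its proof p. 98] [cite: HeathBrown1994SelmerCongruentII, Appendix (Monsky), typescript p. 39 L10–L33] -/
theorem selmerDimFormula_prod_three (h3 : (∏ i, p i) % 8 = 3) :
    selmerDimFormula (∏ i, p i) = 2 + (monskySelmerRankOdd p : ℤ) := by
  have hodd := odd_of_prod_odd p (by omega)
  have hK := finrank_ker_odd_add_two_mul_rank_add_rank_gram (legendreMatrix p)ᵀ
    (fun i => addLegendreSym (-1) (p i)) (fun i => addLegendreSym 2 (p i))
    (transposeA_hLT p hp hodd hinj) (transposeA_sum_col p)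
    (sum_eps_eq_one_of_prod_mod_four p hodd (by omega))
    (Matrix.of fun i l : Fin k =>
      (∑ j, addLegendreSym (-1) (p j) * ((legendreMatrix p)ᵀ i j * (legendreMatrix p)ᵀ l j)) +
        if i = l then addLegendreSym 2 (p i) else 0)
    (fun i l => rfl)
    (Finset.univ.filter fun u : Fin k → ZMod 2 =>
      ∀ j, addLegendreSym (-1) (p j) = 0 → (u ᵥ* (legendreMatrix p)ᵀ) j = 0)
    (fun u => by rw [Finset.mem_filter]; simp only [Finset.mem_univ, true_and])
  have hs : monskySelmerRankOdd p = Module.finrank (ZMod 2) ↥(LinearMap.ker (Matrix.fromBlocks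
      ((legendreMatrix p)ᵀᵀ + Matrix.diagonal fun i => addLegendreSym 2 (p i))
      (Matrix.diagonal fun i => addLegendreSym 2 (p i))
      (Matrix.diagonal fun i => addLegendreSym 2 (p i))
      ((legendreMatrix p)ᵀᵀ + (Matrix.diagonal fun i => addLegendreSym 2 (p i)) +
        Matrix.diagonal fun i => addLegendreSym (-1) (p i))).mulVecLin) := by
    rw [monskySelmerRankOdd_eq_finrank_ker, monskyMatrixOdd_eq_fromBlocks p hp hodd]
  have hΓ := rank_gram_three_add_one p h3
  rw [Fintype.card_fin] at hK
  unfold selmerDimFormula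
  rw [card_sSet_prod p hp hinj, card_tSet_prod_three p hp hodd hinj h3,
    rank_lamMatrix_prod_three_eq p hp hinj h3, rank_gramEssential_prod_three_eq p hp hinj h3, hs]
  omega

/-- **`#Sel₂(E_{p₁⋯p_k}/ℚ) = 2^{2 + s_odd(p₁⋯p_k)}` for `n ≡ 3 (mod 8)`, every `k`, from Aoki's Theorem 2.2 alone**
— the `n ≡ 3 (mod 8)` case of `HeathBrown1994.monsky_card_selmerGroup_two_odd`, from `thm22_card_selmerGroup_two`.
[cite: Aoki1999, Thm. 2.2 p. 81] [cite: HeathBrown1994SelmerCongruentII, Appendix (Monsky), typescript p. 39 L10–L33] -/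
theorem card_selmerGroup_two_prod_three_of_aoki (hAo : thm22_card_selmerGroup_two)
    {k : ℕ} (p : Fin k → ℕ) (hp : ∀ i, (p i).Prime) (hinj : Function.Injective p)
    (h3 : (∏ i, p i) % 8 = 3) :
    Nat.card ((congruentNumberCurve (∏ i, p i)).selmerGroup 2) = 2 ^ (2 + monskySelmerRankOdd p) := by
  obtain ⟨d, hd, hd'⟩ := hAo (∏ i, p i)
    (Nat.pos_of_ne_zero (Finset.prod_ne_zero_iff.mpr fun i _ => (hp i).ne_zero))
    (squarefree_prod_of_injective p hp hinj) (Or.inl h3)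
  rw [selmerDimFormula_prod_three p hp hinj h3] at hd'
  have hd2 : d = 2 + monskySelmerRankOdd p := by omega
  rw [hd, hd2]

end Summit.BirchSwinnertonDyer.Rank1Residual.P2.AokiMonsky

end
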